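import Summits.CriticalPhenomena.PercolationContinuityZ3.Theorems.PercNearOneGluingNoHeavyLowerTailSahiE3MeetContainment
import Mathlib.Tactic.Linarith
import Mathlib.Tactic.Ring
import HarnessLib

/-!
# `NoHeavyLowerTail` (stmt-CriticalPhenomena-4575) — the fourth rung: `E₄` on a slot containing all pairwise meets, and Sahi's `C₄` on meet towers

Support file, seat `prim-l12-p5` (gen 3), `--supports stmt-CriticalPhenomena-4575`.  No definitions, no named facts, no sorries.
Continues `…SahiE3MeetContainment` (`A ∩ C ⊆ B ⇒ E₃(A,B,C) ≥ (2 − μB)·Cov(A,C)`).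

**HIERARCHY IDENTITY, fourth order** (`sahiE_four_eq_of_pairwise_mul_le`, any weight): if the last slot `d` contains every pairwise meet of
`f, g, h` (`{0,1}`-valued; `f·g ≤ d`, `f·h ≤ d`, `g·h ≤ d`), then

  `E₄(f,g,h,d) = (3 − E d)·E₃(f,g,h) + Cov(f,g)·E[h(1−d)] + Cov(f,h)·E[g(1−d)] + Cov(g,h)·E[f(1−d)]`.

(Proof: in Lieb–Sahi's `E₄` the moments `E(fghd), E(ghd), E(fhd), E(fgd)` lose their `d`; then `ring`.)  It is the case `n = 4` of the identity
`E_n(A₁,…,A_{n−1},D) = (n−1−μD)·E_{n−1}(A₁,…,A_{n−1}) + Σ_i μ(A_i ∖ D)·E_{n−2}((A_j)_{j≠i})`, valid whenever `D ⊇ ⋃_{i<j} A_i ∩ A_j`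
(any measure; from the Lieb–Sahi recursion, multilinearity and `E_m(X, B₁,…) = −μ(X)·E_{m−1}(B₁,…)` for `X` disjoint from every `B_j`; verified
exactly for `n ≤ 6`, seat `code/en_meet.py`) — so on MEET TOWERS (`A_k ⊇ A_i ∩ A_j` for all `i < j < k`) Sahi's `C_n` follows from `C_{n−1}`,
`C_{n−2}` on the sub-towers, i.e. by induction from Harris.  This file lands the fourth rung:

* **`sahiE_four_ge_of_pairwise_mul_le`** — FKG probability weight on a finite distributive lattice, monotone `{0,1}` `f, g, h`, any `d ≤ 1`
  containing the pairwise meets: `E₄(f,g,h,d) ≥ (3 − E d)·E₃(f,g,h)` (the three covariances are Harris-nonnegative) — `C₄` on this shape follows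
  from `C₃` of the sub-triple;
* **`sahiE_four_nonneg_of_meetTower`** — if moreover `f·g ≤ h` (so `(f,g,h,d)` is a meet tower), `E₄(f,g,h,d) ≥ 0`: Sahi's `C₄` for every FKG
  weight on every meet tower of length four (e.g. `(x₀∨x₁, x₀∨x₂, x₀∨x₁x₂∨x₃, x₀∨x₁x₂∨x₁x₃∨x₂x₃)`), in particular Kahn-type `E₄ ≥ 0` for such
  up-sets under every product measure.
-/

namespace Summit.CriticalPhenomena.PercolationContinuityZ3.Theorems

namespace SahiMeetTower

open Finset Literature.Combinatorics.Sahi2008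

section Identity

variable {α : Type*} [Fintype α]

/-- `E₃` is symmetric in its last two slots (weight form). [folklore] -/
theorem sahiE_three_swap₂₃ (μ : α → ℝ) (f g h : α → ℝ) : sahiE μ 3 ![f, g, h] = sahiE μ 3 ![f, h, g] := by
  rw [sahiE_three, sahiE_three, mul_right_comm f h g, mul_comm h g]
  ring

/-- **Fourth-order hierarchy identity** (any weight): for `{0,1}`-valued `f, g, h, d` with `f·g ≤ d`, `f·h ≤ d`, `g·h ≤ d` pointwise,
`E₄(f,g,h,d) = (3 − E d)·E₃(f,g,h) + Cov(f,g)·(E h − E(hd)) + Cov(f,h)·(E g − E(gd)) + Cov(g,h)·(E f − E(fd))`. [this file] -/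
theorem sahiE_four_eq_of_pairwise_mul_le (μ : α → ℝ) (f g h d : α → ℝ) (hf01 : ∀ x, f x = 0 ∨ f x = 1)
    (hg01 : ∀ x, g x = 0 ∨ g x = 1) (hh01 : ∀ x, h x = 0 ∨ h x = 1) (hd01 : ∀ x, d x = 0 ∨ d x = 1)
    (hfg : ∀ x, f x * g x ≤ d x) (hfh : ∀ x, f x * h x ≤ d x) (hgh : ∀ x, g x * h x ≤ d x) :
    sahiE μ 4 ![f, g, h, d]
      = (3 - ex μ d) * sahiE μ 3 ![f, g, h]
        + (ex μ (f * g) - ex μ f * ex μ g) * (ex μ h - ex μ (h * d))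
        + (ex μ (f * h) - ex μ f * ex μ h) * (ex μ g - ex μ (g * d))
        + (ex μ (g * h) - ex μ g * ex μ h) * (ex μ f - ex μ (f * d)) := by
  -- the four moments that lose their `d`
  have hpt : ∀ x, f x * g x * h x * d x = f x * g x * h x ∧ g x * h x * d x = g x * h x ∧
      f x * h x * d x = f x * h x ∧ f x * g x * d x = f x * g x := by
    intro x
    have h1 := hfg x; have h2 := hfh x; have h3 := hgh x
    rcases hf01 x with ef | ef <;> rcases hg01 x with eg | eg <;> rcases hh01 x with eh | eh <;>
      rcases hd01 x with ed | ed <;> simp only [ef, eg, eh, ed] at h1 h2 h3 ⊢ <;>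
      exact ⟨by linarith, by linarith, by linarith, by linarith⟩
  have e1 : f * g * h * d = f * g * h := by funext x; simp only [Pi.mul_apply]; exact (hpt x).1
  have e2 : g * h * d = g * h := by funext x; simp only [Pi.mul_apply]; exact (hpt x).2.1
  have e3 : f * h * d = f * h := by funext x; simp only [Pi.mul_apply]; exact (hpt x).2.2.1
  have e4 : f * g * d = f * g := by funext x; simp only [Pi.mul_apply]; exact (hpt x).2.2.2
  rw [sahiE_four, sahiE_three, e1, e2, e3, e4]
  ring

end Identity

section FKG

variable {α : Type*} [DistribLattice α] [Fintype α]

/-- **`C₄` from `C₃` when the last slot contains all pairwise meets.**  FKG probability weight, monotone `{0,1}`-valued `f, g, h`, any `d` with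
values in `{0,1}` containing `f·g`, `f·h`, `g·h`: `E₄(f,g,h,d) ≥ (3 − E d)·E₃(f,g,h)`. [this file] -/
theorem sahiE_four_ge_of_pairwise_mul_le {μ : α → ℝ} (hμ : IsFKGMeasure μ) (f g h d : α → ℝ)
    (hf01 : ∀ x, f x = 0 ∨ f x = 1) (hg01 : ∀ x, g x = 0 ∨ g x = 1) (hh01 : ∀ x, h x = 0 ∨ h x = 1)
    (hd01 : ∀ x, d x = 0 ∨ d x = 1) (hfm : Monotone f) (hgm : Monotone g) (hhm : Monotone h)
    (hfg : ∀ x, f x * g x ≤ d x) (hfh : ∀ x, f x * h x ≤ d x) (hgh : ∀ x, g x * h x ≤ d x) :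
    (3 - ex μ d) * sahiE μ 3 ![f, g, h] ≤ sahiE μ 4 ![f, g, h, d] := by
  have hf0 : ∀ x, 0 ≤ f x := fun x => by rcases hf01 x with e | e <;> simp [e]
  have hg0 : ∀ x, 0 ≤ g x := fun x => by rcases hg01 x with e | e <;> simp [e]
  have hh0 : ∀ x, 0 ≤ h x := fun x => by rcases hh01 x with e | e <;> simp [e]
  have hd1 : ∀ x, d x ≤ 1 := fun x => by rcases hd01 x with e | e <;> simp [e]
  have hμ0 : ∀ x, 0 ≤ μ x := hμ.nonneg
  rw [sahiE_four_eq_of_pairwise_mul_le μ f g h d hf01 hg01 hh01 hd01 hfg hfh hgh]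
  -- Harris for the three pairs and `E X − E(Xd) ≥ 0`
  have cfg : ex μ f * ex μ g ≤ ex μ (f * g) := ex_mul_ex_le_ex_mul hμ hf0 hg0 hfm hgm
  have cfh : ex μ f * ex μ h ≤ ex μ (f * h) := ex_mul_ex_le_ex_mul hμ hf0 hh0 hfm hhm
  have cgh : ex μ g * ex μ h ≤ ex μ (g * h) := ex_mul_ex_le_ex_mul hμ hg0 hh0 hgm hhm
  have dh : ex μ (h * d) ≤ ex μ h := ex_mono hμ0 fun x => by
    simpa [Pi.mul_apply] using mul_le_of_le_one_right (hh0 x) (hd1 x)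
  have dg : ex μ (g * d) ≤ ex μ g := ex_mono hμ0 fun x => by
    simpa [Pi.mul_apply] using mul_le_of_le_one_right (hg0 x) (hd1 x)
  have df : ex μ (f * d) ≤ ex μ f := ex_mono hμ0 fun x => by
    simpa [Pi.mul_apply] using mul_le_of_le_one_right (hf0 x) (hd1 x)
  have t1 := mul_nonneg (sub_nonneg.mpr cfg) (sub_nonneg.mpr dh)
  have t2 := mul_nonneg (sub_nonneg.mpr cfh) (sub_nonneg.mpr dg)
  have t3 := mul_nonneg (sub_nonneg.mpr cgh) (sub_nonneg.mpr df)
  linarith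

/-- **Sahi's `C₄` on meet towers of length four.**  FKG probability weight on a finite distributive lattice; monotone `{0,1}`-valued
`f, g, h, d` with `f·g ≤ h` and `f·g, f·h, g·h ≤ d` (events: `A₃ ⊇ A₁∩A₂`, `A₄ ⊇ (A₁∩A₂) ∪ (A₁∩A₃) ∪ (A₂∩A₃)`): `E₄(f,g,h,d) ≥ 0`. [this file] -/
theorem sahiE_four_nonneg_of_meetTower {μ : α → ℝ} (hμ : IsFKGMeasure μ) (f g h d : α → ℝ)
    (hf01 : ∀ x, f x = 0 ∨ f x = 1) (hg01 : ∀ x, g x = 0 ∨ g x = 1) (hh01 : ∀ x, h x = 0 ∨ h x = 1)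
    (hd01 : ∀ x, d x = 0 ∨ d x = 1) (hfm : Monotone f) (hgm : Monotone g) (hhm : Monotone h)
    (hfgh : ∀ x, f x * g x ≤ h x) (hfg : ∀ x, f x * g x ≤ d x) (hfh : ∀ x, f x * h x ≤ d x) (hgh : ∀ x, g x * h x ≤ d x) :
    0 ≤ sahiE μ 4 ![f, g, h, d] := by
  have hd1 : ∀ x, d x ≤ 1 := fun x => by rcases hd01 x with e | e <;> simp [e]
  have hh1 : ∀ x, h x ≤ 1 := fun x => by rcases hh01 x with e | e <;> simp [e]
  have hμ0 : ∀ x, 0 ≤ μ x := hμ.nonneg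
  -- C₃ for (f, g, h): the third slot contains the meet of the first two (…SahiE3MeetContainment, middle-slot form + slot swap)
  have hE3 : 0 ≤ sahiE μ 3 ![f, g, h] := by
    rw [sahiE_three_swap₂₃]
    exact SahiMeetContainment.sahiE_three_nonneg_of_mul_le hμ f h g hf01 hg01 hh1 hfm hgm hfgh
  have hEd : ex μ d ≤ 1 := by
    have := ex_mono (μ := μ) hμ0 hd1; rwa [ex_const hμ.sum_eq_one] at this
  have key := sahiE_four_ge_of_pairwise_mul_le hμ f g h d hf01 hg01 hh01 hd01 hfm hgm hhm hfg hfh hgh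
  have : 0 ≤ (3 - ex μ d) * sahiE μ 3 ![f, g, h] := mul_nonneg (by linarith) hE3
  linarith

end FKG

/-! ### Appendix (same day): the general fourth-order identity with meet defects

Without any containment hypothesis, for ANY weight and ANY four functions (pure multilinear algebra; `sahiE_four_meet_defect_form`):
`E₄(f,g,h,d) = (3 − E d)·E₃(f,g,h) + Σ_i (E f_i − E f_i d)·Cov(f_j,f_k) + 2·Σ_i E f_i·(E f_jf_k − E f_jf_k d) − 6·(E fgh − E fghd)`;
the last two groups vanish when `d` absorbs the pairwise products (then it is `sahiE_four_eq_of_pairwise_mul_le`).  Hence the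
MEET-DEFECT BOUND `sahiE_four_ge_meet_defect`: for an FKG probability weight and monotone `{0,1}`-valued `f, g, h`, any `{0,1}`-valued `d`,
`E₄(f,g,h,d) ≥ (3 − E d)·E₃(f,g,h) − (6 − 2(E f + E g + E h))·E[fgh(1−d)]` — `C₄` holds for the quadruple as soon as the sub-triple has
`E₃ ≥ 0` and the triple-meet defect `E[fgh(1−d)]` is small enough. -/

section Defect

variable {α : Type*} [Fintype α]

/-- **General fourth-order identity with meet defects** (any weight, any functions). [this file] -/
theorem sahiE_four_meet_defect_form (μ : α → ℝ) (f g h d : α → ℝ) :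
    sahiE μ 4 ![f, g, h, d]
      = (3 - ex μ d) * sahiE μ 3 ![f, g, h]
        + ((ex μ f - ex μ (f * d)) * (ex μ (g * h) - ex μ g * ex μ h)
          + (ex μ g - ex μ (g * d)) * (ex μ (f * h) - ex μ f * ex μ h)
          + (ex μ h - ex μ (h * d)) * (ex μ (f * g) - ex μ f * ex μ g))
        + 2 * (ex μ f * (ex μ (g * h) - ex μ (g * h * d)) + ex μ g * (ex μ (f * h) - ex μ (f * h * d))
          + ex μ h * (ex μ (f * g) - ex μ (f * g * d)))
        - 6 * (ex μ (f * g * h) - ex μ (f * g * h * d)) := by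
  rw [sahiE_four, sahiE_three]
  ring

variable [DistribLattice α]

/-- **Fourth-order meet-defect bound.**  FKG probability weight, monotone `{0,1}`-valued `f, g, h`, `{0,1}`-valued `d`:
`E₄(f,g,h,d) ≥ (3 − E d)·E₃(f,g,h) − (6 − 2(E f + E g + E h))·(E(fgh) − E(fghd))`. [this file] -/
theorem sahiE_four_ge_meet_defect {μ : α → ℝ} (hμ : IsFKGMeasure μ) (f g h d : α → ℝ)
    (hf01 : ∀ x, f x = 0 ∨ f x = 1) (hg01 : ∀ x, g x = 0 ∨ g x = 1) (hh01 : ∀ x, h x = 0 ∨ h x = 1)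
    (hd01 : ∀ x, d x = 0 ∨ d x = 1) (hfm : Monotone f) (hgm : Monotone g) (hhm : Monotone h) :
    (3 - ex μ d) * sahiE μ 3 ![f, g, h]
        - (6 - 2 * (ex μ f + ex μ g + ex μ h)) * (ex μ (f * g * h) - ex μ (f * g * h * d))
      ≤ sahiE μ 4 ![f, g, h, d] := by
  have hf0 : ∀ x, 0 ≤ f x := fun x => by rcases hf01 x with e | e <;> simp [e]
  have hg0 : ∀ x, 0 ≤ g x := fun x => by rcases hg01 x with e | e <;> simp [e]
  have hh0 : ∀ x, 0 ≤ h x := fun x => by rcases hh01 x with e | e <;> simp [e]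
  have hf1 : ∀ x, f x ≤ 1 := fun x => by rcases hf01 x with e | e <;> simp [e]
  have hg1 : ∀ x, g x ≤ 1 := fun x => by rcases hg01 x with e | e <;> simp [e]
  have hh1 : ∀ x, h x ≤ 1 := fun x => by rcases hh01 x with e | e <;> simp [e]
  have hd0 : ∀ x, 0 ≤ d x := fun x => by rcases hd01 x with e | e <;> simp [e]
  have hd1 : ∀ x, d x ≤ 1 := fun x => by rcases hd01 x with e | e <;> simp [e]
  have hμ0 : ∀ x, 0 ≤ μ x := hμ.nonneg
  rw [sahiE_four_meet_defect_form μ f g h d]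
  -- Harris for the three pairs, nonnegativity of the defect factors
  have cfg : ex μ f * ex μ g ≤ ex μ (f * g) := ex_mul_ex_le_ex_mul hμ hf0 hg0 hfm hgm
  have cfh : ex μ f * ex μ h ≤ ex μ (f * h) := ex_mul_ex_le_ex_mul hμ hf0 hh0 hfm hhm
  have cgh : ex μ g * ex μ h ≤ ex μ (g * h) := ex_mul_ex_le_ex_mul hμ hg0 hh0 hgm hhm
  have df : ex μ (f * d) ≤ ex μ f := ex_mono hμ0 fun x => by
    simpa [Pi.mul_apply] using mul_le_of_le_one_right (hf0 x) (hd1 x)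
  have dg : ex μ (g * d) ≤ ex μ g := ex_mono hμ0 fun x => by
    simpa [Pi.mul_apply] using mul_le_of_le_one_right (hg0 x) (hd1 x)
  have dh : ex μ (h * d) ≤ ex μ h := ex_mono hμ0 fun x => by
    simpa [Pi.mul_apply] using mul_le_of_le_one_right (hh0 x) (hd1 x)
  have ha0 : 0 ≤ ex μ f := ex_nonneg hμ0 hf0
  have hb0 : 0 ≤ ex μ g := ex_nonneg hμ0 hg0
  have hc0 : 0 ≤ ex μ h := ex_nonneg hμ0 hh0
  -- the pair defects dominate the triple defect: E(f_jf_k) − E(f_jf_kd) ≥ E(fgh) − E(fghd)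
  have pgh : ex μ (f * g * h) - ex μ (f * g * h * d) ≤ ex μ (g * h) - ex μ (g * h * d) := by
    have e1 : ex μ (g * h) - ex μ (g * h * d) = ex μ (fun x => g x * h x * (1 - d x)) := by
      unfold ex; rw [← Finset.sum_sub_distrib]; exact Finset.sum_congr rfl fun x _ => by simp only [Pi.mul_apply]; ring
    have e2 : ex μ (f * g * h) - ex μ (f * g * h * d) = ex μ (fun x => f x * g x * h x * (1 - d x)) := by
      unfold ex; rw [← Finset.sum_sub_distrib]; exact Finset.sum_congr rfl fun x _ => by simp only [Pi.mul_apply]; ring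
    rw [e1, e2]
    refine ex_mono hμ0 fun x => ?_
    have := mul_le_of_le_one_left (mul_nonneg (mul_nonneg (hg0 x) (hh0 x)) (sub_nonneg.mpr (hd1 x))) (hf1 x)
    nlinarith [this, hg0 x, hh0 x, hd1 x, hf0 x]
  have pfh : ex μ (f * g * h) - ex μ (f * g * h * d) ≤ ex μ (f * h) - ex μ (f * h * d) := by
    have e1 : ex μ (f * h) - ex μ (f * h * d) = ex μ (fun x => f x * h x * (1 - d x)) := by
      unfold ex; rw [← Finset.sum_sub_distrib]; exact Finset.sum_congr rfl fun x _ => by simp only [Pi.mul_apply]; ring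
    have e2 : ex μ (f * g * h) - ex μ (f * g * h * d) = ex μ (fun x => f x * g x * h x * (1 - d x)) := by
      unfold ex; rw [← Finset.sum_sub_distrib]; exact Finset.sum_congr rfl fun x _ => by simp only [Pi.mul_apply]; ring
    rw [e1, e2]
    refine ex_mono hμ0 fun x => ?_
    nlinarith [hg1 x, hg0 x, mul_nonneg (mul_nonneg (hf0 x) (hh0 x)) (sub_nonneg.mpr (hd1 x))]
  have pfg : ex μ (f * g * h) - ex μ (f * g * h * d) ≤ ex μ (f * g) - ex μ (f * g * d) := by
    have e1 : ex μ (f * g) - ex μ (f * g * d) = ex μ (fun x => f x * g x * (1 - d x)) := by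
      unfold ex; rw [← Finset.sum_sub_distrib]; exact Finset.sum_congr rfl fun x _ => by simp only [Pi.mul_apply]; ring
    have e2 : ex μ (f * g * h) - ex μ (f * g * h * d) = ex μ (fun x => f x * g x * h x * (1 - d x)) := by
      unfold ex; rw [← Finset.sum_sub_distrib]; exact Finset.sum_congr rfl fun x _ => by simp only [Pi.mul_apply]; ring
    rw [e1, e2]
    refine ex_mono hμ0 fun x => ?_
    nlinarith [hh1 x, hh0 x, mul_nonneg (mul_nonneg (hf0 x) (hg0 x)) (sub_nonneg.mpr (hd1 x))]
  have t1 := mul_nonneg (sub_nonneg.mpr df) (sub_nonneg.mpr cgh)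
  have t2 := mul_nonneg (sub_nonneg.mpr dg) (sub_nonneg.mpr cfh)
  have t3 := mul_nonneg (sub_nonneg.mpr dh) (sub_nonneg.mpr cfg)
  have u1 := mul_le_mul_of_nonneg_left pgh ha0
  have u2 := mul_le_mul_of_nonneg_left pfh hb0
  have u3 := mul_le_mul_of_nonneg_left pfg hc0
  nlinarith [t1, t2, t3, u1, u2, u3]

end Defect

end SahiMeetTower

end Summit.CriticalPhenomena.PercolationContinuityZ3.Theorems
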